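import Summits.FinalStateConjecture.FinalStateConjecture.Theses.SwallowTheDatum
import Literature.Geometry.Lorentzian.AdmissibleMGHDExistence
import Literature.Geometry.Lorentzian.CauchyProblemMGHDExistenceProofs

/-!
# Route SwallowTheDatum · item `MGHDExists` (stmt-FinalStateConjecture-9937) — conditional closure
# and reduction to the two inputs of Choquet-Bruhat–Geroch's proof

The route decl `Summit.FinalStateConjecture.FinalStateConjecture.Theses.SwallowTheDatum.MGHDExists`
(shared by the routes of summit `FinalStateConjecture` under the names `MGHDExists`,
`MGHDExistence`, `AdmissibleMGHDExists`, `MaximalDevelopmentExists`) reads: for every connected,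
Hausdorff, second countable smooth `3`-manifold `X` and every Christodoulou-admissible vacuum datum
`D ∈ admissibleVacuumData X` there is a maximal vacuum Cauchy development
`𝒟 : VacuumCauchyDevelopment D`, `𝒟.IsMaximal` (Choquet-Bruhat–Geroch, Comm. Math. Phys. 14
(1969), Thm. 3, p. 332; Sbierski, Ann. Henri Poincaré 17 (2016), Thm. 2.8; Ringström 2009,
Thm. 16.6).

This statement is, verbatim, the named fact
`Literature.Geometry.Lorentzian.choquetBruhat_geroch_exists_mghd_cauchy`
(`CauchyProblemMGHDExistence.lean`) restricted to the admissible class — the tree already records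
the restriction as `choquetBruhat_geroch_exists_mghd_cauchy.forall_mem_admissibleVacuumData`
(`AdmissibleMGHDExistence.lean`). The fact is undischarged: its proof is the local existence and
local geometric uniqueness theory of the vacuum Einstein equations in wave gauge together with the
union/gluing of developments (quasilinear hyperbolic systems, exponential-map rigidity, quotient
manifolds), none of which Mathlib carries at the pin. Accordingly this file lands

* `mghdExists_of_choquetBruhatGeroch` — the CONDITIONAL closure of the item from the named fact
  (trust base: Choquet-Bruhat–Geroch 1969, Thm. 3) — the route decl is, as a proposition, the
  conclusion of `choquetBruhat_geroch_exists_mghd_cauchy.forall_mem_admissibleVacuumData`;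
* `mghdExists_of_chains_bounded_of_common_extension` (and the equivalence
  `mghdExists_iff_chains_bounded_and_common_extension`) — the item from the two constructions of the
  printed proof of Theorem 3 RESTRICTED TO ADMISSIBLE DATA: (i) every chain (for "is extended by",
  `CauchyDevelopment.EmbedsInto`) of vacuum Cauchy developments of an admissible datum has an upper
  bound (Thm. 1 = local existence for the empty chain; the union development of a chain, p. 333),
  (ii) any two vacuum Cauchy developments of an admissible datum embed into a common one (Thm. 2 =
  local geometric uniqueness, with the gluing-along-the-maximal-common-development and Hausdorff
  argument of pp. 333–334; Sbierski 2016, Thm. 2.7). The remaining step is Zorn's lemma, already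
  formalized as `VacuumCauchyDevelopment.exists_isMaximal_of_chains_bounded_of_common_extension`
  (`CauchyProblemMGHDExistenceProofs.lean`). This displays exactly what an unconditional proof of
  the item still owes, in the weakest form the item needs (admissible data only).

No definition is introduced; nothing is restated.
-/

noncomputable section

open scoped Manifold ContDiff

namespace Summit.FinalStateConjecture.FinalStateConjecture.Theorems

open Literature.Geometry.Lorentzian

/-- **Conditional closure of item `MGHDExists` (stmt-FinalStateConjecture-9937).** Under the named
fact `choquetBruhat_geroch_exists_mghd_cauchy` (Choquet-Bruhat–Geroch 1969, Thm. 3: every smooth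
solution of the vacuum constraints on a connected Hausdorff second countable `3`-manifold has a
maximal vacuum Cauchy development), every admissible vacuum datum has a maximal vacuum Cauchy
development — the route decl `SwallowTheDatum.MGHDExists`. One line over the tree corollary
`choquetBruhat_geroch_exists_mghd_cauchy.exists_isMaximal_of_mem_admissibleVacuumData` (which
supplies the Levi-Civita instance by `PseudoRiemannianMetric.hasLeviCivita` and the constraint
hypothesis by `isVacuumConstraintSolution_of_mem_admissibleVacuumData`). CONDITIONAL: trust base =
the undischarged fact. -/
theorem mghdExists_of_choquetBruhatGeroch (h : choquetBruhat_geroch_exists_mghd_cauchy) :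
    Summit.FinalStateConjecture.FinalStateConjecture.Theses.SwallowTheDatum.MGHDExists := by
  unfold Theses.SwallowTheDatum.MGHDExists
  intro X _ _ _ _ _ _ D hD
  exact h.exists_isMaximal_of_mem_admissibleVacuumData hD

/-- **Item `MGHDExists` from the two inputs of the printed proof of Choquet-Bruhat–Geroch's
Theorem 3, restricted to admissible data.** If for every admissible vacuum datum `D` on a
connected Hausdorff second countable smooth `3`-manifold `X` (i) every chain of vacuum Cauchy
developments of `D` (preordered by `CauchyDevelopment.EmbedsInto`, the empty chain included) has
an upper bound — Choquet-Bruhat–Geroch 1969, Thm. 1 (local existence, p. 331) and the union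
development of a chain (p. 333) — and (ii) any two vacuum Cauchy developments of `D` embed into a
common one — Thm. 2 (local geometric uniqueness, p. 331) with the gluing and Hausdorff argument of
pp. 333–334, i.e. Sbierski 2016, Thm. 2.7 — then `MGHDExists` holds: Zorn's lemma in the form
`VacuumCauchyDevelopment.exists_isMaximal_of_chains_bounded_of_common_extension`. Both hypotheses
are consequences of the (undischarged) fact `choquetBruhat_geroch_exists_mghd_cauchy`
(`IsMaximal.chains_bounded`, `IsMaximal.common_extension`), so this is the finest reduction of
the item the tree's vocabulary currently expresses. -/
theorem mghdExists_of_chains_bounded_of_common_extension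
    (hchain : ∀ (X : Type) [TopologicalSpace X] [ChartedSpace E3 X] [IsManifold (𝓡 3) ∞ X]
      [T2Space X] [SecondCountableTopology X] [ConnectedSpace X] (D : InitialDataSet (𝓡 3) X),
      D ∈ admissibleVacuumData X → ∀ c : Set (VacuumCauchyDevelopment D),
        IsChain (fun 𝒟₁ 𝒟₂ ↦ 𝒟₁.toCauchyDevelopment.EmbedsInto 𝒟₂.toCauchyDevelopment) c →
          ∃ ub : VacuumCauchyDevelopment D,
            ∀ 𝒟 ∈ c, 𝒟.toCauchyDevelopment.EmbedsInto ub.toCauchyDevelopment)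
    (hce : ∀ (X : Type) [TopologicalSpace X] [ChartedSpace E3 X] [IsManifold (𝓡 3) ∞ X]
      [T2Space X] [SecondCountableTopology X] [ConnectedSpace X] (D : InitialDataSet (𝓡 3) X),
      D ∈ admissibleVacuumData X → ∀ 𝒟₁ 𝒟₂ : VacuumCauchyDevelopment D,
        ∃ 𝒟₃ : VacuumCauchyDevelopment D,
          𝒟₁.toCauchyDevelopment.EmbedsInto 𝒟₃.toCauchyDevelopment ∧
            𝒟₂.toCauchyDevelopment.EmbedsInto 𝒟₃.toCauchyDevelopment) :
    Summit.FinalStateConjecture.FinalStateConjecture.Theses.SwallowTheDatum.MGHDExists := by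
  unfold Theses.SwallowTheDatum.MGHDExists
  intro X _ _ _ _ _ _ D hD
  exact VacuumCauchyDevelopment.exists_isMaximal_of_chains_bounded_of_common_extension
    (hchain X D hD) (hce X D hD)

/-- Conversely, `MGHDExists` gives back both inputs for admissible data: a maximal vacuum Cauchy
development bounds every chain and is a common extension of any two developments (the trivial
direction, "Theorem 2.8 clearly implies Theorem 2.7", Sbierski 2016). Together with
`mghdExists_of_chains_bounded_of_common_extension`: over the prelude the item is EQUIVALENT to the
conjunction of the two printed-proof inputs on the admissible class. -/
theorem mghdExists_iff_chains_bounded_and_common_extension :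
    Summit.FinalStateConjecture.FinalStateConjecture.Theses.SwallowTheDatum.MGHDExists ↔
      (∀ (X : Type) [TopologicalSpace X] [ChartedSpace E3 X] [IsManifold (𝓡 3) ∞ X]
        [T2Space X] [SecondCountableTopology X] [ConnectedSpace X] (D : InitialDataSet (𝓡 3) X),
        D ∈ admissibleVacuumData X → ∀ c : Set (VacuumCauchyDevelopment D),
          IsChain (fun 𝒟₁ 𝒟₂ ↦ 𝒟₁.toCauchyDevelopment.EmbedsInto 𝒟₂.toCauchyDevelopment) c →
            ∃ ub : VacuumCauchyDevelopment D,
              ∀ 𝒟 ∈ c, 𝒟.toCauchyDevelopment.EmbedsInto ub.toCauchyDevelopment) ∧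
      (∀ (X : Type) [TopologicalSpace X] [ChartedSpace E3 X] [IsManifold (𝓡 3) ∞ X]
        [T2Space X] [SecondCountableTopology X] [ConnectedSpace X] (D : InitialDataSet (𝓡 3) X),
        D ∈ admissibleVacuumData X → ∀ 𝒟₁ 𝒟₂ : VacuumCauchyDevelopment D,
          ∃ 𝒟₃ : VacuumCauchyDevelopment D,
            𝒟₁.toCauchyDevelopment.EmbedsInto 𝒟₃.toCauchyDevelopment ∧
              𝒟₂.toCauchyDevelopment.EmbedsInto 𝒟₃.toCauchyDevelopment) := by
  constructor
  · intro h
    refine ⟨fun X _ _ _ _ _ _ D hD c _ ↦ ?_, fun X _ _ _ _ _ _ D hD 𝒟₁ 𝒟₂ ↦ ?_⟩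
    · obtain ⟨𝒟, h𝒟⟩ := h X D hD
      exact h𝒟.chains_bounded c
    · obtain ⟨𝒟, h𝒟⟩ := h X D hD
      exact h𝒟.common_extension 𝒟₁ 𝒟₂
  · rintro ⟨hchain, hce⟩
    exact mghdExists_of_chains_bounded_of_common_extension hchain hce

end Summit.FinalStateConjecture.FinalStateConjecture.Theorems

end
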